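import Summits.HodgeConjecture.HodgeConjecture.Theorems.H413RallisTransportConsumption
import Literature.NumberTheory.Automorphic.UnitaryGroupAdelicProduct
import Mathlib.Topology.Algebra.PontryaginDual
import HarnessLib

/-!
# FLOOR-0 P4, seat N3 — THE PIN CHARACTER OF THE MODEL CHARACTER: `χ′` on `[U(⟨a₀⟩)]` with
# `χ′([g]) = c₂([e⁻¹ g]) · χ̃([e⁻¹ g])⁻¹`, and its archimedean ∕ finite split

Cell hodgecm-mathlib (D-0151), FLOOR 0, crux item H413 = stmt-HodgeConjecture-24833; programme P4, line
`Cruxes/H413/Lines/F0_P4AdmissibleOccursInH1.lean` ED. 2, stub S4b; the (26)-assembly capstone ★ p795212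
`Theorems/H413ThetaDistNonvanishingOfRallis.lean` (F0P4-p02) takes as hypotheses `(χ′) (hχ′ : ∀ g, χ′([g]) = c₂([e⁻¹ g]) · charInv χ̃ ([e⁻¹ g]))`
and `(hχw : ∀ h, conj χ′([h]) = conj (χinf h_∞) · wfin h_f)` — row **N3** of its «remaining inputs», assigned to this seat (F0P4-p02 23:24:39Z,
F0P4-plan (g2) 23:04:56Z (δ)).  Author F0P4-p05 (g0).  `--supports stmt-HodgeConjecture-24833` (helper; DEF-FREE).
Namespace `Summit.HodgeConjecture.HodgeConjecture.Cruxes.H413.RallisTransport` (binders of ★ `H413RallisTransport`).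

WHAT IS PROVED (kernel):

* §1 (generic) a continuous MULTIPLICATIVE function on a COMPACT topological group has values of norm one
  (`norm_eq_one_of_map_mul_of_compactSpace`), and a continuous multiplicative norm-one function on a topological group IS a
  `PontryaginDual` element (`exists_pontryaginDual_coe_eq`);
* §2 **the J-R multiplier is unitary** (`norm_twistMultiplier_eq_one`): `‖η₀(1, t♭) · χ₀(1, e t)‖ = 1` for every `t ∈ U(1)(𝔸)` — it descends to
  the compact `[U(1)]` (★ `RallisTransport.exists_kappa`; automorphic by ★ `twist_eq_one`) and is multiplicative there; hence `‖c₂‖ = 1`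
  for the descended inverse multiplier `c₂` of ★ `kernelDatum_thetaLift_ne_zero_iff_canonical`;
* §3 **N3, EXISTENCE OF THE PIN CHARACTER** (`exists_pinChar`): for every automorphic character `χ̃ : PontryaginDual [U(1)]` of the model and the
  continuous `c₂` with `c₂(t̄) = (η₀(1,t♭)·χ₀(1,e t))⁻¹`, there is `χ′ : PontryaginDual (U(⟨a₀⟩)(𝔸) ⧸ U(⟨a₀⟩)(L⁺))` with
  `χ′([g]) = c₂([e⁻¹ g]) · charInv χ̃ ([e⁻¹ g])` for all `g` (`e = cmLineTorusEquiv`) — token-for-token the `hχ′` of ★ brick 11;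
* §4 (generic) **the archimedean ∕ finite split** of ANY `χ′ : PontryaginDual (U(J)(𝔸) ⧸ U(J)(F))` (`conj_coe_mk_eq_arch_mul_fin`):
  `conj χ′([h]) = conj χ′([h_∞ · 1]) · conj χ′([1 · h_f])` with `χ′([h_∞·1]) · conj χ′([h_∞·1]) = 1` — the `hχw`∕`hχ` rows of ★
  `thetaLift_charCM_tmul_ne_zero_of_finCoeff_ne_zero` with `χinf a := χ′([archToAdelic a])`, `wfin b := conj χ′([finAdelicToAdelic b])`.

NOT here: the identification of that `χinf` with the eigencharacter of the harmonic vector `D.Φarch ℓ` under the archimedean `W`-centre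
((A), `heig` — F0P4-p07 ∕ arch desk).  HC_CM is proved only modulo the printed citations until rung 0 closes; this file proves nothing about them.

## References (conventions only; nothing of print is asserted)
* [Godement1964] R. Godement, Sém. Bourbaki 257 (1964), §5 Thm. 4 (automorphic characters of anisotropic tori are unitary).
* [GelbartRogawski1991] S. Gelbart, J. Rogawski, Invent. Math. 105 (1991), §3.1 Remark p. 457 L4–13.
* [BorelJacquet1979] A. Borel, H. Jacquet, Proc. Sympos. Pure Math. 33.1 (1979), §4.1 (`G(𝔸) = G_∞ × G(𝔸_f)`).
* [Liu2021] Y. Liu, Camb. J. Math. 9 (2021), proof of Prop. 4.13 (l. 2145).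
-/

set_option autoImplicit false
set_option linter.dupNamespace false

noncomputable section

open _root_.MeasureTheory
open NumberField hiding relNormOneIdeles relNormOneRat probHaarRelNormOneQuot
open scoped Matrix ComplexConjugate
open Literature.NumberTheory.Automorphic Literature.NumberTheory.Automorphic.UnitaryGroup Literature.NumberTheory.Weil1964
open Literature.NumberTheory.Weil1964.ThetaKernelDatum
open Literature.NumberTheory.GelbartRogawski1991 Literature.NumberTheory.GelbartRogawski1991.UnitaryDualPair
open Literature.MeasureTheory.Group
open HodgeCM HodgeCM.Adelic HodgeCM.PerL34 HodgeCM.Model HodgeCM.Model.ArchSideTerm HodgeCM.Model.SupplyResidual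
open HodgeCM.Model.SupplyResidual.WeilPairData (charInv charInv_apply)

namespace Summit.HodgeConjecture.HodgeConjecture.Cruxes.H413.RallisTransport

/-! ## §1 Generic: continuous multiplicative functions on compact groups are unitary; unitary ones are Pontryagin duals -/

section Generic

variable {K : Type*} [Group K] [TopologicalSpace K]

/-- a continuous multiplicative `g : K → ℂ` with `g 1 = 1` on a COMPACT topological group takes values of norm `1` (its range is bounded
and closed under powers and inverses). [cite: Godement1964, §5 Thm. 4] -/
theorem norm_eq_one_of_map_mul_of_compactSpace [CompactSpace K] (g : C(K, ℂ)) (h1 : g 1 = 1)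
    (hmul : ∀ x y : K, g (x * y) = g x * g y) (k : K) : ‖g k‖ = 1 := by
  -- `‖g x‖ ≤ 1` for every `x`: otherwise `‖g (x ^ n)‖ = ‖g x‖ ^ n` is unbounded
  have hpow : ∀ (x : K) (n : ℕ), g (x ^ n) = g x ^ n := fun x n => by
    induction n with
    | zero => rw [pow_zero, pow_zero, h1]
    | succ n ih => rw [pow_succ, hmul, ih, pow_succ]
  have hle : ∀ x : K, ‖g x‖ ≤ 1 := fun x => by
    by_contra hx
    rw [not_le] at hx
    obtain ⟨n, hn⟩ := pow_unbounded_of_one_lt ‖g‖ hx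
    have h := ContinuousMap.norm_coe_le_norm g (x ^ n)
    rw [hpow, norm_pow] at h
    exact absurd (hn.trans_le h) (lt_irrefl _)
  have hinv : g k⁻¹ * g k = 1 := by rw [← hmul, inv_mul_cancel, h1]
  have hk0 : g k ≠ 0 := fun h => by rw [h, mul_zero] at hinv; exact zero_ne_one hinv
  refine le_antisymm (hle k) ?_
  have h := hle k⁻¹
  rw [← inv_eq_of_mul_eq_one_left hinv, norm_inv] at h
  exact (inv_le_one₀ (norm_pos_iff.2 hk0)).1 h

/-- a continuous multiplicative norm-one `g : K → ℂ` IS an element `χ` of the Pontryagin dual with `χ x = g x`.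
[cite: Godement1964, §5 Thm. 4] -/
theorem exists_pontryaginDual_coe_eq [IsTopologicalGroup K] (g : C(K, ℂ)) (h1 : g 1 = 1)
    (hmul : ∀ x y : K, g (x * y) = g x * g y) (hnorm : ∀ x : K, ‖g x‖ = 1) :
    ∃ χ : PontryaginDual K, ∀ x : K, ((χ x : Circle) : ℂ) = g x := by
  refine ⟨{ toFun := fun x => ⟨g x, mem_sphere_zero_iff_norm.2 (hnorm x)⟩
            map_one' := Circle.ext (by simpa using h1)
            map_mul' := fun x y => Circle.ext (by simpa using hmul x y)
            continuous_toFun := ?_ }, fun x => rfl⟩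
  exact Continuous.subtype_mk g.continuous _

end Generic

/-! ## §2 The J-R multiplier is unitary -/

section Pin

variable {L : CMField} {ι₁ : L →+* ℂ} (V : HermSpace3 L ι₁) (hV : IsAnisotropic L V.Hm) (S : StubTree.SeesawDatum L)
variable
  (hGR : (cmSplittingDatum (L : Type) finProdFinEquiv (frameD V) (frameD_real V) (frameD_ne V) (dW S) (dW_real S) (dW_ne S)).CompatibleSplitting)
  (hGR₀ : (cmSplittingDatum (L : Type) (e₁) (frameD V) (frameD_real V) (frameD_ne V) (lineVec (L : Type) (dW S 0))
    (fun _ => dW_real S 0) (fun _ => dW_ne S 0)).CompatibleSplitting)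
  (hGR₁ : (cmSplittingDatum (L : Type) (e₁) (frameD V) (frameD_real V) (frameD_ne V) (lineVec (L : Type) (dW S 1))
    (fun _ => dW_real S 1) (fun _ => dW_ne S 1)).CompatibleSplitting)
  (hGR₂ : (cmSplittingDatum (L : Type) (e₁) (frameD V) (frameD_real V) (frameD_ne V) (lineVec (L : Type) (dW' S 0))
    (fun _ => dW'_real S 0) (fun _ => dW'_ne S 0)).CompatibleSplitting)
  (hGR₃ : (cmSplittingDatum (L : Type) (e₁) (frameD V) (frameD_real V) (frameD_ne V) (lineVec (L : Type) (dW' S 1))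
    (fun _ => dW'_real S 1) (fun _ => dW'_ne S 1)).CompatibleSplitting)
  (η₀ η₁ η₂ η₃ : CMAdelic (L : Type) (frameD V) × CMAdelicOne (L : Type) →* ℂˣ)
  (P : WeilPairData (↥(maximalRealSubfield L)) (L : Type) (Fin 3) ↥(regimeSubgroup L V.Hm))
  (hPω : P.ω = lineRepOf V S hGR hGR₀ hGR₁ hGR₂ hGR₃ η₀ η₁ η₂ η₃ 0) (hPΓ : P.ΓU = regimeRat L V.Hm)
  (hρ : HasThetaMajorants fun
    (p : CMAdelic (L : Type) (frameD V) × CMAdelic (L : Type) (lineVec (L : Type) (dW S 0)))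
    (Φ : piSchwartzBruhat (↥(maximalRealSubfield L)) (Fin 3)) =>
      cmPairRep (L : Type) e₁ (frameD V) (frameD_real V) (frameD_ne V) (lineVec (L : Type) (dW S 0))
        (fun _ => dW_real S 0) (fun _ => dW_ne S 0) hGR₀ p Φ)
  (SK : Set (piSchwartzBruhat (↥(maximalRealSubfield L)) (Fin 3)))
  (hSK : ∀ (h : CMAdelic (L : Type) (lineVec (L : Type) (dW S 0))) (Φ : piSchwartzBruhat (↥(maximalRealSubfield L)) (Fin 3)),
    Φ ∈ SK → cmPairRep (L : Type) e₁ (frameD V) (frameD_real V) (frameD_ne V) (lineVec (L : Type) (dW S 0))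
      (fun _ => dW_real S 0) (fun _ => dW_ne S 0) hGR₀ (1, h) Φ ∈ SK)
  (hc : Continuous fun t : ↥(relNormOneIdeles (↥(maximalRealSubfield L)) L) =>
    ((η₀ (1, (cmAdelicOneEquivRelNormOne (L : Type)).symm t) *
        cmLineChar₀ (L : Type) finProdFinEquiv e₁ (frameD V) (frameD_real V) (frameD_ne V) (dW S) (dW_real S) (dW_ne S)
          hGR hGR₀ hGR₁ (1, cmLineTorusEquiv (L : Type) (dW S 0) (dW_ne S 0) t) : ℂˣ) : ℂ))

include hV hPω hPΓ hc in
/-- **THE J-R MULTIPLIER IS UNITARY**: `‖η₀(1, t♭) · χ₀(1, e t)‖ = 1` for every norm-one idèle `t` — the character `t ↦ η₀(1,t♭)·χ₀(1,e t)` is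
continuous (`hc`), trivial on `U(1)(L⁺)` (★ `twist_eq_one`), hence a continuous character of the compact `[U(1)]` (★ `exists_kappa`), hence unitary.
[cite: Godement1964, §5 Thm. 4; GelbartRogawski1991, §3.1 Remark p. 457 L4–13] -/
theorem norm_twistMultiplier_eq_one (t : ↥(relNormOneIdeles (↥(maximalRealSubfield L)) L)) :
    ‖((η₀ (1, (cmAdelicOneEquivRelNormOne (L : Type)).symm t) *
        cmLineChar₀ (L : Type) finProdFinEquiv e₁ (frameD V) (frameD_real V) (frameD_ne V) (dW S) (dW_real S) (dW_ne S)
          hGR hGR₀ hGR₁ (1, cmLineTorusEquiv (L : Type) (dW S 0) (dW_ne S 0) t) : ℂˣ) : ℂ)‖ = 1 := by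
  letI : MeasurableSpace (CMAdelic (L : Type) (lineVec (L : Type) (dW S 0)) ⧸ CMRat (L : Type) (lineVec (L : Type) (dW S 0))) := borel _
  haveI : BorelSpace (CMAdelic (L : Type) (lineVec (L : Type) (dW S 0)) ⧸ CMRat (L : Type) (lineVec (L : Type) (dW S 0))) := ⟨rfl⟩
  obtain ⟨κ, hκ⟩ := exists_kappa V S hGR hGR₀ hGR₁ hGR₂ hGR₃ η₀ η₁ η₂ η₃
    ((regimeEquiv L V.Hm hV).symm.trans (cmFrameEquiv (L : Type) (frameG V) V.Hm (frameD V) (frame_congr V))).toMulEquiv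
    (fun _ => rfl) (cmLineTorusEquiv (L : Type) (dW S 0) (dW_ne S 0)) (cmLineTorusEquiv_apply (L : Type) (dW S 0) (dW_ne S 0))
    P hPω hPΓ (cmLineTorusEquiv_mem_CMRat_iff (L : Type) (dW S 0) (dW_ne S 0)) hc
  -- the explicit multiplier is a homomorphism in `t`
  obtain ⟨c, hc', -⟩ := exists_twist_lineRepOf_zero V S hGR hGR₀ hGR₁ hGR₂ hGR₃ η₀ η₁ η₂ η₃
    ((regimeEquiv L V.Hm hV).symm.trans (cmFrameEquiv (L : Type) (frameG V) V.Hm (frameD V) (frame_congr V))).toMulEquiv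
    (fun _ => rfl) (cmLineTorusEquiv (L : Type) (dW S 0) (dW_ne S 0)) (cmLineTorusEquiv_apply (L : Type) (dW S 0) (dW_ne S 0))
  have hκc : ∀ u : ↥(relNormOneIdeles (↥(maximalRealSubfield L)) L), κ (QuotientGroup.mk u) = ((c (1, u) : ℂˣ) : ℂ) := fun u => by
    rw [hκ, hc']
    simp only [map_one]
  have h1 : κ 1 = 1 := by
    rw [← QuotientGroup.mk_one, hκc, ← Prod.one_eq_mk, map_one, Units.val_one]
  have hmul : ∀ x y, κ (x * y) = κ x * κ y := fun x y => by
    induction x using QuotientGroup.induction_on with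
    | H u =>
      induction y using QuotientGroup.induction_on with
      | H v =>
        rw [← QuotientGroup.mk_mul, hκc, hκc, hκc]
        have h : (((1 : ↥(regimeSubgroup L V.Hm)), u * v) : ↥(regimeSubgroup L V.Hm) × _) = (1, u) * (1, v) := by simp
        rw [h, map_mul, Units.val_mul]
  have h := norm_eq_one_of_map_mul_of_compactSpace κ h1 hmul (QuotientGroup.mk t)
  rwa [hκ] at h

/-! ## §3 N3: the pin character `χ′` -/

variable [(CMRat (L : Type) (lineVec (L : Type) (dW S 0))).Normal]
  (c₂ : C(↥(relNormOneIdeles (↥(maximalRealSubfield L)) L) ⧸ relNormOneRat (↥(maximalRealSubfield L)) L, ℂ))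
  (hc₂ : ∀ t : ↥(relNormOneIdeles (↥(maximalRealSubfield L)) L),
    c₂ (QuotientGroup.mk t) =
      (((η₀ (1, (cmAdelicOneEquivRelNormOne (L : Type)).symm t) *
          cmLineChar₀ (L : Type) finProdFinEquiv e₁ (frameD V) (frameD_real V) (frameD_ne V) (dW S) (dW_real S) (dW_ne S)
            hGR hGR₀ hGR₁ (1, cmLineTorusEquiv (L : Type) (dW S 0) (dW_ne S 0) t))⁻¹ : ℂˣ) : ℂ))
  (χ : PontryaginDual (↥(relNormOneIdeles (↥(maximalRealSubfield L)) L) ⧸ relNormOneRat (↥(maximalRealSubfield L)) L))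

include hV hPω hPΓ hc hc₂ in
/-- **N3 — THE PIN CHARACTER EXISTS.**  For the model's automorphic character `χ̃` of `[U(1)]` and the continuous descended multiplier `c₂`
(`c₂(t̄) = (η₀(1,t♭)·χ₀(1,e t))⁻¹`), there is a continuous unitary character `χ′` of `[U(⟨a₀⟩)] = U(⟨a₀⟩)(𝔸) ⧸ U(⟨a₀⟩)(L⁺)` with
`χ′([g]) = c₂([e⁻¹ g]) · charInv χ̃ ([e⁻¹ g])` for every `g` (`e = cmLineTorusEquiv`) — the hypothesis `hχ′` of ★ brick 11
`dist_ne_zero_of_rallis_of_eigen_of_finCoeff`, token-for-token. [cite: Godement1964, §5 Thm. 4; GelbartRogawski1991, §3.1 Remark p. 457 L4–13; Liu2021, proof of Prop. 4.13 (l. 2145)] -/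
theorem exists_pinChar :
    ∃ χ' : PontryaginDual (CMAdelic (L : Type) (lineVec (L : Type) (dW S 0)) ⧸ CMRat (L : Type) (lineVec (L : Type) (dW S 0))),
      ∀ g : CMAdelic (L : Type) (lineVec (L : Type) (dW S 0)),
        ((χ' (QuotientGroup.mk g) : Circle) : ℂ) =
          c₂ (QuotientGroup.mk ((cmLineTorusEquiv (L : Type) (dW S 0) (dW_ne S 0)).symm g)) *
            charInv χ (QuotientGroup.mk ((cmLineTorusEquiv (L : Type) (dW S 0) (dW_ne S 0)).symm g)) := by
  -- the candidate weight on `[U(⟨a₀⟩)]`: `(c₂ · charInv χ̃) ∘ cosetCongr e⁻¹`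
  let a : C(CMAdelic (L : Type) (lineVec (L : Type) (dW S 0)) ⧸ CMRat (L : Type) (lineVec (L : Type) (dW S 0)),
      ↥(relNormOneIdeles (↥(maximalRealSubfield L)) L) ⧸ relNormOneRat (↥(maximalRealSubfield L)) L) :=
    ⟨cosetCongr (cmLineTorusEquiv (L : Type) (dW S 0) (dW_ne S 0)).symm (CMRat (L : Type) (lineVec (L : Type) (dW S 0)))
        (relNormOneRat (↥(maximalRealSubfield L)) L)
        (forall_symm_mem_iff _ _ _ (cmLineTorusEquiv_mem_CMRat_iff (L : Type) (dW S 0) (dW_ne S 0))),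
      continuous_cosetCongr _ _ _ (forall_symm_mem_iff _ _ _ (cmLineTorusEquiv_mem_CMRat_iff (L : Type) (dW S 0) (dW_ne S 0)))
        (continuous_cmLineTorusEquiv_symm (L : Type) (dW S 0) (dW_ne S 0))⟩
  have ha : ∀ g, a (QuotientGroup.mk g) = QuotientGroup.mk ((cmLineTorusEquiv (L : Type) (dW S 0) (dW_ne S 0)).symm g) :=
    fun _ => rfl
  let g₀ : C(CMAdelic (L : Type) (lineVec (L : Type) (dW S 0)) ⧸ CMRat (L : Type) (lineVec (L : Type) (dW S 0)), ℂ) :=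
    (c₂ * charInv χ).comp a
  have hg₀ : ∀ g, g₀ (QuotientGroup.mk g) =
      c₂ (QuotientGroup.mk ((cmLineTorusEquiv (L : Type) (dW S 0) (dW_ne S 0)).symm g)) *
        charInv χ (QuotientGroup.mk ((cmLineTorusEquiv (L : Type) (dW S 0) (dW_ne S 0)).symm g)) := fun _ => rfl
  -- `c₂` on representatives is the INVERSE multiplier, a homomorphism in `t`
  obtain ⟨c, hc', -⟩ := exists_twist_lineRepOf_zero V S hGR hGR₀ hGR₁ hGR₂ hGR₃ η₀ η₁ η₂ η₃
    ((regimeEquiv L V.Hm hV).symm.trans (cmFrameEquiv (L : Type) (frameG V) V.Hm (frameD V) (frame_congr V))).toMulEquiv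
    (fun _ => rfl) (cmLineTorusEquiv (L : Type) (dW S 0) (dW_ne S 0)) (cmLineTorusEquiv_apply (L : Type) (dW S 0) (dW_ne S 0))
  have hc₂c : ∀ u : ↥(relNormOneIdeles (↥(maximalRealSubfield L)) L),
      c₂ (QuotientGroup.mk u) = (((c (1, u))⁻¹ : ℂˣ) : ℂ) := fun u => by
    rw [hc₂, hc']
    simp only [map_one]
  -- multiplicativity of the weight
  have h1 : g₀ 1 = 1 := by
    rw [← QuotientGroup.mk_one, hg₀, map_one, hc₂c, charInv_apply, QuotientGroup.mk_one, inv_one, map_one]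
    have h11 : (((1 : ↥(regimeSubgroup L V.Hm)), (1 : ↥(relNormOneIdeles (↥(maximalRealSubfield L)) L))) :
        ↥(regimeSubgroup L V.Hm) × ↥(relNormOneIdeles (↥(maximalRealSubfield L)) L)) = 1 := rfl
    rw [h11, map_one, inv_one, Units.val_one, one_mul]
    rfl
  have hmul : ∀ x y, g₀ (x * y) = g₀ x * g₀ y := fun x y => by
    induction x using QuotientGroup.induction_on with
    | H g =>
      induction y using QuotientGroup.induction_on with
      | H g' =>
        rw [← QuotientGroup.mk_mul, hg₀, hg₀, hg₀, map_mul, QuotientGroup.mk_mul, ← QuotientGroup.mk_mul, hc₂c, hc₂c, hc₂c,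
          charInv_apply, charInv_apply, charInv_apply, QuotientGroup.mk_mul]
        have h : (((1 : ↥(regimeSubgroup L V.Hm)),
            (cmLineTorusEquiv (L : Type) (dW S 0) (dW_ne S 0)).symm g * (cmLineTorusEquiv (L : Type) (dW S 0) (dW_ne S 0)).symm g') :
              ↥(regimeSubgroup L V.Hm) × _) =
            (1, (cmLineTorusEquiv (L : Type) (dW S 0) (dW_ne S 0)).symm g) * (1, (cmLineTorusEquiv (L : Type) (dW S 0) (dW_ne S 0)).symm g') := by
          simp
        rw [h]
        simp only [map_inv, map_mul, Circle.coe_mul, Circle.coe_inv, Units.val_inv_eq_inv_val, Units.val_mul]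
        ring
  -- norm one of the weight
  have hnorm : ∀ x, ‖g₀ x‖ = 1 := fun x => by
    induction x using QuotientGroup.induction_on with
    | H g =>
      rw [hg₀, norm_mul, hc₂, Units.val_inv_eq_inv_val, norm_inv,
        norm_twistMultiplier_eq_one V hV S hGR hGR₀ hGR₁ hGR₂ hGR₃ η₀ η₁ η₂ η₃ P hPω hPΓ hc, inv_one, one_mul,
        charInv_apply, Circle.norm_coe]
  obtain ⟨χ', hχ'⟩ := exists_pontryaginDual_coe_eq g₀ h1 hmul hnorm
  exact ⟨χ', fun g => (hχ' (QuotientGroup.mk g)).trans (hg₀ g)⟩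

end Pin

/-! ## §4 Generic: the archimedean ∕ finite split of a character of `[U(J)]` -/

section Split

variable (F E : Type) [Field F] [NumberField F] [Field E] [NumberField E] [Algebra F E] (c : E ≃ₐ[F] E) (N : ℕ)
  (J : Matrix (Fin N) (Fin N) E) [(UnitaryGroup.toAdelic F E c N J).range.Normal]
  (χ' : PontryaginDual (↥(UnitaryGroup.adelic F E c N J) ⧸ (UnitaryGroup.toAdelic F E c N J).range))

/-- unitarity on the archimedean section: `χ′([h_∞·1]) · conj χ′([h_∞·1]) = 1` (the `hχ` row of ★
`thetaLift_charCM_tmul_ne_zero_of_finCoeff_ne_zero` for `χinf a := χ′([archToAdelic a])`). [cite: BorelJacquet1979, §4.1] -/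
theorem coe_mk_archToAdelic_mul_conj (a : UnitaryGroup.arch F E c N J) :
    ((χ' (QuotientGroup.mk (UnitaryGroup.archToAdelic F E c N J a)) : Circle) : ℂ) *
        conj ((χ' (QuotientGroup.mk (UnitaryGroup.archToAdelic F E c N J a)) : Circle) : ℂ) = 1 := by
  rw [Complex.mul_conj, Complex.normSq_eq_norm_sq, Circle.norm_coe, one_pow, Complex.ofReal_one]

/-- **the archimedean ∕ finite split**: `conj χ′([h]) = conj χ′([h_∞·1]) · conj χ′([1·h_f])` — the `hχw` row of ★
`thetaLift_charCM_tmul_ne_zero_of_finCoeff_ne_zero` ∕ ★ brick 11 with `χinf a := χ′([archToAdelic a])`, `wfin b := conj χ′([finAdelicToAdelic b])`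
(`h = (h_∞·1)(1·h_f)`, ★ `archToAdelic_mul_finAdelicToAdelic`). [cite: BorelJacquet1979, §4.1] -/
theorem conj_coe_mk_eq_arch_mul_fin (h : UnitaryGroup.adelic F E c N J) :
    conj ((χ' (QuotientGroup.mk h) : Circle) : ℂ) =
      conj ((χ' (QuotientGroup.mk (UnitaryGroup.archToAdelic F E c N J (UnitaryGroup.archPart F E c N J h))) : Circle) : ℂ) *
        conj ((χ' (QuotientGroup.mk (UnitaryGroup.finAdelicToAdelic F E c N J (UnitaryGroup.finPart F E c N J h))) : Circle) : ℂ) := by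
  have hprod : (QuotientGroup.mk h : ↥(UnitaryGroup.adelic F E c N J) ⧸ (UnitaryGroup.toAdelic F E c N J).range) =
      (QuotientGroup.mk (UnitaryGroup.archToAdelic F E c N J (UnitaryGroup.archPart F E c N J h)) :
          ↥(UnitaryGroup.adelic F E c N J) ⧸ (UnitaryGroup.toAdelic F E c N J).range) *
        (QuotientGroup.mk (UnitaryGroup.finAdelicToAdelic F E c N J (UnitaryGroup.finPart F E c N J h)) :
          ↥(UnitaryGroup.adelic F E c N J) ⧸ (UnitaryGroup.toAdelic F E c N J).range) := by
    rw [← QuotientGroup.mk_mul]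
    exact congrArg QuotientGroup.mk (UnitaryGroup.archToAdelic_mul_finAdelicToAdelic F E c N J h).symm
  rw [hprod, map_mul, Circle.coe_mul, map_mul]

end Split

end Summit.HodgeConjecture.HodgeConjecture.Cruxes.H413.RallisTransport
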